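import Mathlib
import Summits.ValiantsHypothesis.ValiantsHypothesis.Theorems.NewtonUnitEquationsDissociatedUniformTotalsLaw
import Summits.ValiantsHypothesis.ValiantsHypothesis.Theorems.NewtonUnitEquationsDissociatedUniformTotalsLawSweep
import Summits.ValiantsHypothesis.ValiantsHypothesis.Theorems.NewtonUnitEquationsDissociatedUniformTotalsLawHeavyPairs
import Summits.ValiantsHypothesis.ValiantsHypothesis.Theorems.NewtonUnitEquationsDissociatedUniformTotalsLawTriangleWords
import Summits.ValiantsHypothesis.ValiantsHypothesis.Theorems.NewtonUnitEquationsDissociatedUniformTotalsLawChartSamples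
import Summits.ValiantsHypothesis.ValiantsHypothesis.Theorems.NewtonUnitEquationsDissociatedUniformTotalsLawChartTriangles
import Literature.Computability.AlgebraicComplexity.NewtonPolygonTauProductBounds
import HarnessLib

/-!
# Crux `NewtonUnitEquations.DissociatedUniform` (stmt-ValiantsHypothesis-5905), `n = 3` totals law of model (Q**):
# THE FIRST SUB-CUBIC GENERAL BOUND — `T(a, b, c) ≤ 108 (√|G| + 1) |G|²` for ALL configurations

Model (Q**) (`Cruxes/DissociatedUniform/NOTES-d1g3.md`; typed in `…DissociatedUniformTotalsLaw`): a finite abelian group `G`, curves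
`a b c : G → ℝ²`, classes `{a x + b y + c z : x + y + z = s}`, `T = ∑_s #vert conv(class s)`.  Known before: the trivial
`T ≤ |G|³` (`totalVert_le_card_cube`), the law `T ≤ C|G|²` on regimes/strata, and the shallow/deep dichotomy.  THIS FILE: for EVERY
finite abelian `G` and ALL `a b c` (no injectivity, no general position),

  `totalVert a b c ≤ 6 · (2K|G|² + 16|G|³/K)` for every `K ≥ 1` (`totalVert_le_of_K`), hence
  `totalVert a b c ≤ 108 · (Nat.sqrt |G| + 1) · |G|²` (`totalVert_le_sqrt`), i.e. `T = O(|G|^{5/2})` (`totalVert_pow_two_le`).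

Proof (three companion files): every hull vertex of a class is a chart top (`…Sweep.classVert_le_card_chartTops_add`); chart tops,
read through their least spellings at generic sample times, are TRIANGLE WORDS of the three tie-broken pair-top systems, which are
INTERVAL SYSTEMS along a half-chart (`…ChartSamples`, `…ChartTriangles`); a triangle word is a triangle at the birth of one of its pairs, and the words
born through a pair `(x, y)` are at most `min(deg y, deg x)` at that time (`…TriangleWords`); pairs born while both letters are
`m`-heavy are `≤ 8|G|³/m²` because a heavy run starts at a strong up-crossing that consumes `m/2` fresh fibre entries, of which there
are `≤ |G|²` in all (`…HeavyPairs`); a dyadic layer cake finishes.  In the language of NOTES-t1g11 §3 this is the first bound on DEEP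
vertices valid for arbitrary labellings; the located law `TotalsLawThree C` (exponent 2) remains OPEN and is asserted nowhere;
VP ≠ VNP is not touched.
[folklore]
-/

set_option linter.dupNamespace false -- `ValiantsHypothesis.ValiantsHypothesis` (summit = problem) in every name

open Finset Matrix

namespace Summit.ValiantsHypothesis.ValiantsHypothesis.Theorems.NewtonUnitEquationsDissociatedUniform

namespace TotalsLaw

open Literature.Computability.AlgebraicComplexity.KPTT.PlanarMinkowski

variable {G : Type*} [AddCommGroup G] [Fintype G] [DecidableEq G]

open Classical in
/-- **Per half-chart.**  `∑_s #tops_σ(class s) ≤ 3 (2K|G|² + 16|G|³/K)` for `σ ≠ 0`, `K ≥ 1`. [folklore] -/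
theorem sum_card_chartTops_le_of_K (a b c : G → (Fin 2 → ℝ)) {σ : ℝ} (hσ : σ ≠ 0) {K : ℕ} (hK : 1 ≤ K) :
    ∑ s, ((univ.image fun p : G × G => a p.1 + b p.2 + c (s - p.1 - p.2)).filter fun v =>
        ∃ t, IsStrictTop ![σ, t] (univ.image fun p : G × G => a p.1 + b p.2 + c (s - p.1 - p.2)) v).card ≤
      3 * (2 * K * Fintype.card G ^ 2 + 16 * Fintype.card G ^ 3 / K) :=
  (sum_card_chartTops_le_card_triWords a b c σ).trans
    (card_triWords_le (isIntervalSys_TPs hσ _) (isIntervalSys_TQs hσ _) (isIntervalSys_TRs hσ _) hK)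

/-- **Sub-cubic bound, parametric form.**  `T(a,b,c) ≤ 6 (2K|G|² + 16|G|³/K)` for every `K ≥ 1`, every finite abelian `G`
and all curves `a b c`. [folklore] -/
theorem totalVert_le_of_K (a b c : G → (Fin 2 → ℝ)) {K : ℕ} (hK : 1 ≤ K) :
    totalVert a b c ≤ 6 * (2 * K * Fintype.card G ^ 2 + 16 * Fintype.card G ^ 3 / K) := by
  classical
  have h₁ := sum_card_chartTops_le_of_K a b c (σ := 1) one_ne_zero hK
  have h₂ := sum_card_chartTops_le_of_K a b c (σ := -1) (by norm_num) hK
  unfold totalVert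
  calc ∑ s, classVert a b c s ≤ _ := sum_le_sum fun s _ => classVert_le_card_chartTops_add a b c s
    _ ≤ 3 * (2 * K * Fintype.card G ^ 2 + 16 * Fintype.card G ^ 3 / K) +
        3 * (2 * K * Fintype.card G ^ 2 + 16 * Fintype.card G ^ 3 / K) := by
        rw [sum_add_distrib]; exact add_le_add h₁ h₂
    _ = 6 * (2 * K * Fintype.card G ^ 2 + 16 * Fintype.card G ^ 3 / K) := by ring

/-- **THE FIRST SUB-CUBIC GENERAL BOUND: `T ≤ 108 (⌊√|G|⌋ + 1) |G|²`** for every finite abelian `G` and all `a b c : G → ℝ²`.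
[folklore] -/
theorem totalVert_le_sqrt (a b c : G → (Fin 2 → ℝ)) :
    totalVert a b c ≤ 108 * (Nat.sqrt (Fintype.card G) + 1) * Fintype.card G ^ 2 := by
  set q := Fintype.card G with hq
  set k := Nat.sqrt q with hk
  have hK : 1 ≤ k + 1 := by omega
  have hmain := totalVert_le_of_K a b c hK
  have hlt : q < (k + 1) * (k + 1) := by have := Nat.lt_succ_sqrt' q; rw [hk, ← pow_two]; exact this
  -- `16 q³ / (k+1) ≤ 16 (k+1) q²`
  have hdiv : 16 * q ^ 3 / (k + 1) ≤ 16 * (k + 1) * q ^ 2 := by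
    refine (Nat.div_le_div_right (c := k + 1) (show 16 * q ^ 3 ≤ 16 * ((k + 1) * (k + 1)) * q ^ 2 from ?_)).trans ?_
    · have : q ^ 3 ≤ (k + 1) * (k + 1) * q ^ 2 := by
        rw [pow_succ, mul_comm]
        exact Nat.mul_le_mul_right _ hlt.le
      calc 16 * q ^ 3 ≤ 16 * ((k + 1) * (k + 1) * q ^ 2) := Nat.mul_le_mul_left _ this
        _ = 16 * ((k + 1) * (k + 1)) * q ^ 2 := by ring
    · rw [show 16 * ((k + 1) * (k + 1)) * q ^ 2 = (16 * (k + 1) * q ^ 2) * (k + 1) by ring, Nat.mul_div_cancel _ (by omega)]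
  calc totalVert a b c ≤ 6 * (2 * (k + 1) * q ^ 2 + 16 * q ^ 3 / (k + 1)) := hmain
    _ ≤ 6 * (2 * (k + 1) * q ^ 2 + 16 * (k + 1) * q ^ 2) := by gcongr
    _ = 108 * (k + 1) * q ^ 2 := by ring

/-- `T = O(|G|^{5/2})` in exponent form: `T² ≤ 216² · |G|⁵`. [folklore] -/
theorem totalVert_pow_two_le (a b c : G → (Fin 2 → ℝ)) :
    totalVert a b c ^ 2 ≤ 46656 * Fintype.card G ^ 5 := by
  set q := Fintype.card G with hq
  set k := Nat.sqrt q with hk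
  have h := totalVert_le_sqrt a b c
  have hk2 : k * k ≤ q := by have := Nat.sqrt_le' q; rw [hk, ← pow_two]; exact this
  have hq1 : 1 ≤ q := Fintype.card_pos
  -- `(k+1)² ≤ 4q`
  have hk1 : (k + 1) * (k + 1) ≤ 4 * q := by nlinarith
  calc totalVert a b c ^ 2 ≤ (108 * (k + 1) * q ^ 2) ^ 2 := Nat.pow_le_pow_left h 2
    _ = 11664 * ((k + 1) * (k + 1)) * q ^ 4 := by ring
    _ ≤ 11664 * (4 * q) * q ^ 4 := by gcongr
    _ = 46656 * q ^ 5 := by ring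

/-- The sub-cubic bound in the shape of the located law: `∀ G a b c, T ≤ 108 (√|G| + 1)|G|²` (compare `TotalsLawThree C :
T ≤ C|G|²`, OPEN). [folklore] -/
theorem totalsLaw_fiveHalves :
    ∀ (G : Type) [AddCommGroup G] [Fintype G] (a b c : G → (Fin 2 → ℝ)),
      totalVert a b c ≤ 108 * (Nat.sqrt (Fintype.card G) + 1) * Fintype.card G ^ 2 := by
  intro G _ _ a b c
  classical
  exact totalVert_le_sqrt a b c

end TotalsLaw

end Summit.ValiantsHypothesis.ValiantsHypothesis.Theorems.NewtonUnitEquationsDissociatedUniform
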